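import Summits.ValiantsHypothesis.ValiantsHypothesis.Theorems.DivisionGapPerDivisionHardStubLureCutsOut

/-!
# Crux `DivisionGap.PerDivisionHard` (stmt-ValiantsHypothesis-5065), line `pair-descent-jss-endpoint` —
stub `stub_pricedCut`: priced steered weights (admissible cut with a prescribed top fibre)

`stub_pricedCut`: for a placement `eR, eC` of the block graph `G = placedBlock eR eC`, disjoint
padding index sets `P, Q` (lure rows / lure column owners), PRICES `u` with `1 ≤ u e` on every OFF
cell `e` (neither a face cell nor a lure cell `(eR (pad p), eC (pad q))`, `p ∈ P`, `q ∈ Q`), and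
any `h` all of whose monomials have the same degree, there is an admissible weight `w`
(`CutsOut w G`) whose top fibre of `h` is exactly the set of monomials of `h` minimising the price
`U(m) = Σ_{e off} u e · m e`.

Proof.  Put `B := 1 + Σ_e u e` (so `u e < B` for every cell) and `w e := B - u e` on the off cells,
`w e := B` on the face and lure cells.  Then `w = B` on face ∪ lures and `w < B` off them
(`u ≥ 1` there), so `CutsOut w G` is `stub_lureCutsOut`.  For every exponent vector `m`,
`weight_w m + U(m) = B · deg m` (split the cells into off / not off), and all monomials of `h`
have the same degree, so over `supp h` "maximal `w`-weight" ⟺ "minimal price"; finally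
`m ∈ supp (topComponent w h)` ⟺ `m ∈ supp h` with `weight_w m = weightedTotalDegree_w h`
(`coeff_topComponent`) ⟺ `m ∈ supp h` with maximal `w`-weight over `supp h`.
-/

noncomputable section

-- `Summit.ValiantsHypothesis.ValiantsHypothesis.…` is the tree's mandated single-conjunct layout
-- (Sub = Summit), so the duplicated namespace component is intended.
set_option linter.dupNamespace false

namespace Summit.ValiantsHypothesis.ValiantsHypothesis.Theorems.DivisionGapPerDivisionHard

open MvPolynomial Literature.Computability.AlgebraicComplexity
open Summit.ValiantsHypothesis.ValiantsHypothesis.Theorems.ZeroOneTransfer.Negative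
  (topComponent coeff_topComponent)
open scoped NNReal BigOperators

/-- Membership in the top `w`-fibre: `d ∈ supp (topComponent w p)` iff `d ∈ supp p` and the
`w`-weight of `d` is maximal over `supp p` (`coeff_topComponent`; `weightedTotalDegree` is the
`sup` of the weights over the support). [folklore] -/
theorem priced_mem_support_topComponent_iff {ι : Type*} (w : ι → ℕ) (p : MvPolynomial ι ℝ≥0)
    (d : ι →₀ ℕ) :
    d ∈ (topComponent w p).support ↔
      d ∈ p.support ∧ ∀ d' ∈ p.support, Finsupp.weight w d' ≤ Finsupp.weight w d := by
  rw [mem_support_iff, coeff_topComponent]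
  constructor
  · intro hd
    by_cases hw : Finsupp.weight w d = weightedTotalDegree w p
    · rw [if_pos hw] at hd
      refine ⟨mem_support_iff.mpr hd, fun d' hd' => ?_⟩
      rw [hw]
      exact le_weightedTotalDegree w hd'
    · rw [if_neg hw] at hd
      exact absurd rfl hd
  · rintro ⟨hd, hmax⟩
    rw [if_pos (le_antisymm (le_weightedTotalDegree w hd) (Finset.sup_le hmax))]
    exact mem_support_iff.mp hd

/-- The weight/price identity of a priced weight: if `w e + u e = B` on the cells of `Off` and
`w e = B` off `Off`, then `weight_w m + Σ_{e ∈ Off} u e · m e = B · deg m` for every exponent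
vector `m`. [folklore] -/
theorem priced_weight_add_price {ι : Type*} [Fintype ι] (Off : Finset ι) (u w : ι → ℕ) (B : ℕ)
    (hon : ∀ e ∈ Off, w e + u e = B) (hoff : ∀ e ∉ Off, w e = B) (mo : ι →₀ ℕ) :
    Finsupp.weight w mo + ∑ e ∈ Off, u e * mo e = B * mo.degree := by
  classical
  have h1 : Finsupp.weight w mo = ∑ e, w e * mo e := by
    rw [Finsupp.weight_apply, Finsupp.sum_fintype _ _ (fun i => by simp)]
    simp only [smul_eq_mul]
    exact Finset.sum_congr rfl fun e _ => mul_comm _ _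
  have h2 : ∑ e ∈ Off, u e * mo e = ∑ e, (if e ∈ Off then u e else 0) * mo e :=
    (Finset.sum_congr rfl fun e he => by simp [he]).trans
      (Finset.sum_subset (Finset.subset_univ Off) fun e _ he => by simp [he])
  rw [h1, h2, ← Finset.sum_add_distrib, Finsupp.degree_eq_sum, Finset.mul_sum]
  refine Finset.sum_congr rfl fun e _ => ?_
  rw [← add_mul]
  by_cases he : e ∈ Off
  · rw [if_pos he, hon e he]
  · rw [if_neg he, add_zero, hoff e he]

/-- The top fibre of a priced weight: if `w e + u e = B` on `Off`, `w e = B` off `Off`, and all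
monomials of `h` have the same degree, then `m ∈ supp (topComponent w h)` iff `m ∈ supp h` and
`m` minimises the price `Σ_{e ∈ Off} u e · m e` over `supp h`. [folklore] -/
theorem priced_mem_topComponent_iff {ι : Type*} [Fintype ι] (Off : Finset ι) (u w : ι → ℕ)
    (B : ℕ) (hon : ∀ e ∈ Off, w e + u e = B) (hoff : ∀ e ∉ Off, w e = B)
    (h : MvPolynomial ι ℝ≥0)
    (hdeg : ∀ m₁ ∈ h.support, ∀ m₂ ∈ h.support, m₁.degree = m₂.degree) (mo : ι →₀ ℕ) :
    mo ∈ (topComponent w h).support ↔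
      (mo ∈ h.support ∧ ∀ mo' ∈ h.support,
        ∑ e ∈ Off, u e * mo e ≤ ∑ e ∈ Off, u e * mo' e) := by
  rw [priced_mem_support_topComponent_iff]
  refine and_congr_right fun hmo => forall₂_congr fun mo' hmo' => ?_
  have h1 := priced_weight_add_price Off u w B hon hoff mo
  have h2 := priced_weight_add_price Off u w B hon hoff mo'
  rw [hdeg mo hmo mo' hmo'] at h1
  constructor
  · intro hle
    omega
  · intro hle
    omega

/-- **`stub_pricedCut` — priced steered weights.**  For a placement `eR, eC`, disjoint padding
index sets `P, Q` (lure rows / lure column owners), prices `u` with `1 ≤ u e` on every cell `e`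
that is neither a face cell nor a lure cell `(eR (pad p), eC (pad q))`, and any `h` all of whose
monomials have the same degree, there is an admissible weight `w` (`CutsOut`) whose top fibre of
`h` is precisely the set of monomials of `h` minimising `Σ_{e off} u e · m e`.  Construction:
`B := 1 + Σ_e u e`, `w e := B` on face and lure cells, `w e := B − u e` on the off cells; then
`weight_w m + Σ_off u e · m e = B · deg m` (`priced_weight_add_price`), so with equal degrees
"maximal `w`-weight" ⟺ "minimal price" (`priced_mem_topComponent_iff`), and `CutsOut` is
`stub_lureCutsOut` (`w = B` on face ∪ lures, `< B` elsewhere since `u ≥ 1`). [folklore] -/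
theorem stub_pricedCut :
    ∀ (b k m n : ℕ) (eR eC : BlockV b k m ≃ Fin n) (P Q : Finset (Fin m)) (u : Fin n × Fin n → ℕ)
      (h : MvPolynomial (Fin n × Fin n) ℝ≥0), Disjoint P Q →
      (∀ e : Fin n × Fin n, e ∉ placedBlock eR eC →
        (¬ ∃ p ∈ P, ∃ q ∈ Q, e = (eR (Sum.inr (Sum.inr p)), eC (Sum.inr (Sum.inr q)))) → 1 ≤ u e) →
      (∀ m₁ ∈ h.support, ∀ m₂ ∈ h.support, m₁.degree = m₂.degree) →
      ∃ w : Fin n × Fin n → ℕ, CutsOut w (placedBlock eR eC) ∧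
        ∀ mo : (Fin n × Fin n) →₀ ℕ, mo ∈ (topComponent w h).support ↔
          (mo ∈ h.support ∧ ∀ mo' ∈ h.support,
            (∑ e ∈ (Finset.univ : Finset (Fin n × Fin n)).filter (fun e => e ∉ placedBlock eR eC ∧
                ¬ ∃ p ∈ P, ∃ q ∈ Q, e = (eR (Sum.inr (Sum.inr p)), eC (Sum.inr (Sum.inr q)))),
                u e * mo e) ≤
            ∑ e ∈ (Finset.univ : Finset (Fin n × Fin n)).filter (fun e => e ∉ placedBlock eR eC ∧
                ¬ ∃ p ∈ P, ∃ q ∈ Q, e = (eR (Sum.inr (Sum.inr p)), eC (Sum.inr (Sum.inr q)))),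
                u e * mo' e) := by
  intro b k m n eR eC P Q u h hPQ hu hdeg
  -- the OFF cells: neither face cells nor lure cells
  obtain ⟨Off, hOff⟩ : ∃ Off : Finset (Fin n × Fin n), Off =
      (Finset.univ : Finset (Fin n × Fin n)).filter (fun e => e ∉ placedBlock eR eC ∧
        ¬ ∃ p ∈ P, ∃ q ∈ Q, e = (eR (Sum.inr (Sum.inr p)), eC (Sum.inr (Sum.inr q)))) :=
    ⟨_, rfl⟩
  have hmemOff : ∀ e, e ∈ Off ↔ (e ∉ placedBlock eR eC ∧
      ¬ ∃ p ∈ P, ∃ q ∈ Q, e = (eR (Sum.inr (Sum.inr p)), eC (Sum.inr (Sum.inr q)))) := fun e => by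
    rw [hOff, Finset.mem_filter]
    simp only [Finset.mem_univ, true_and]
  -- the common level `B > u e` of the face and lure cells
  obtain ⟨B, hB⟩ : ∃ B : ℕ, B = 1 + ∑ e, u e := ⟨_, rfl⟩
  have hu_lt : ∀ e, u e < B := fun e => by
    have : u e ≤ ∑ e, u e :=
      Finset.single_le_sum (f := u) (fun _ _ => Nat.zero_le _) (Finset.mem_univ e)
    omega
  -- the priced weight
  obtain ⟨w, hw⟩ : ∃ w : Fin n × Fin n → ℕ, ∀ e, w e = if e ∈ Off then B - u e else B :=
    ⟨_, fun _ => rfl⟩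
  have hon : ∀ e ∈ Off, w e + u e = B := fun e he => by
    rw [hw, if_pos he]
    have := hu_lt e
    omega
  have hoff : ∀ e ∉ Off, w e = B := fun e he => by rw [hw, if_neg he]
  refine ⟨w, ?_, ?_⟩
  · -- admissibility: `w = B` on face ∪ lures, `< B` on the off cells
    refine stub_lureCutsOut b k m n eR eC P Q B w hPQ ?_ ?_ ?_
    · intro e he
      exact hoff e fun h' => ((hmemOff e).mp h').1 he
    · intro p hp q hq
      exact hoff _ fun h' => ((hmemOff _).mp h').2 ⟨p, hp, q, hq, rfl⟩
    · intro e he hne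
      have h1 := hon e ((hmemOff e).mpr ⟨he, hne⟩)
      have h2 := hu e he hne
      omega
  · -- the top fibre = the price minimisers
    intro mo
    rw [priced_mem_topComponent_iff Off u w B hon hoff h hdeg mo, hOff]

end Summit.ValiantsHypothesis.ValiantsHypothesis.Theorems.DivisionGapPerDivisionHard

end
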